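import Summits.AtomisticToContinuum.FouriersLaw.Theorems.BondHeatUncertaintySubdiffusiveBondHeatBathBondReductionDynkin
import Summits.AtomisticToContinuum.FouriersLaw.Theorems.BondHeatUncertaintyLinearResponseFTURNessFacts

/-!
# Helper 7 for stub `stub_bondHeatVarianceContinuity` (crux ★ `LinearResponseFTUR`, stmt-AtomisticToContinuum-9122):
# energy truncation of the current–current kernel pairing, uniformly in the temperatures

Support file for line `lebesgue-flip-duality`, stub K6b. The second moment of the bond heat along the
stationary flow is `2∫₀ᵗ (t-r) F(r) dr` with the kernel pairing `F(r) = ∫ j · (P_r j) dμ`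
(`SubdiffusiveBondHeat.pinnedChain_timeIntegral_sq`). This file bounds, for ANY law `μ` invariant under the
constructed kernels with an exponential moment `∫ e^{ϑH} dμ ≤ M`, the error made in `F(r)` when the current
`j` is replaced by its energy truncation `j_K = χ_K(H) j` (continuous, compactly supported):
`|∫ j·(P_r j) dμ - ∫ j_K·(P_r j_K) dμ| ≤ 2 √(C² e^{-ϑK/2} (M+1)) (1 + C²M)` (`pairing_cutoff_approx`), by the
`L²` bound `|∫ f·(P_r h) dμ| ≤ λ ∫f² + λ⁻¹ ∫h²` (the tree's AM–GM bound `pinnedChain_abs_kernelPairing_le`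
rescaled) and the tail estimate `(j - j_K)² ≤ C² e^{-ϑK/2} e^{ϑH}`. Also: the exponential domination of the
currents with an explicit positive constant. Nothing here closes an item.
-/

noncomputable section

namespace Summit.AtomisticToContinuum.FouriersLaw.Theorems.LinearResponseFTUR

open MeasureTheory ProbabilityTheory Filter Topology Set
open scoped NNReal ENNReal Topology
open Literature.MathematicalPhysics.KineticTheory.HeatConduction Literature.Probability.Process OscillatorChain
open Summit.AtomisticToContinuum.FouriersLaw.Theorems.SubdiffusiveBondHeat

/-- **Exponential moments dominate the currents, with a positive constant**: for every `ε > 0` there is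
`C > 0` with `|j_i| ≤ C e^{εH}` (pinned chain, `ω₂, lam, β ≥ 0`). [folklore] -/
theorem k6b_abs_bondCurrent_le_exp {ω₂ lam β : ℝ} (hω : 0 ≤ ω₂) (hl : 0 ≤ lam) (hβ : 0 ≤ β) (γ : ℝ)
    (N : ℕ) (i : Fin N) {ε : ℝ} (hε : 0 < ε) :
    ∃ C : ℝ, 0 < C ∧ ∀ x, |(pinnedChain ω₂ lam β γ).bondCurrent N i x| ≤
      C * Real.exp (ε * (pinnedChain ω₂ lam β γ).hamiltonian N x) := by
  refine ⟨N * ((3 + β) / 2) * (2 * Real.exp ε / ε ^ 2) + 1, by positivity, fun x => ?_⟩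
  have hH0 := pinnedChain_hamiltonian_nonneg hω hl hβ γ N x
  have hj := pinnedChain_abs_bondCurrent_le hω hl hβ γ N i x
  have hsq := one_add_sq_le_exp hH0 hε
  have hpos := Real.exp_pos (ε * (pinnedChain ω₂ lam β γ).hamiltonian N x)
  calc |(pinnedChain ω₂ lam β γ).bondCurrent N i x|
      ≤ N * ((3 + β) / 2 * (1 + (pinnedChain ω₂ lam β γ).hamiltonian N x) ^ 2) := hj
    _ = N * ((3 + β) / 2) * (1 + (pinnedChain ω₂ lam β γ).hamiltonian N x) ^ 2 := by ring
    _ ≤ N * ((3 + β) / 2) * (2 * Real.exp ε / ε ^ 2 *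
          Real.exp (ε * (pinnedChain ω₂ lam β γ).hamiltonian N x)) :=
        mul_le_mul_of_nonneg_left hsq (by positivity)
    _ ≤ (N * ((3 + β) / 2) * (2 * Real.exp ε / ε ^ 2) + 1) *
          Real.exp (ε * (pinnedChain ω₂ lam β γ).hamiltonian N x) := by nlinarith only [hpos]

section Pairing

variable {ω₂ lam β γ : ℝ} (hω : 0 < ω₂) (hl : 0 ≤ lam) (hβ : 0 ≤ β) (hγ : 0 ≤ γ) (N : ℕ) (a b : ℝ)
include hω hl hβ hγ

/-- **Rescaled `L²` bound on the kernel pairing**: for `f, h ∈ L²(μ)`, `μ` invariant, and every `λ > 0`,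
`|∫ f · (P_{u⁺} h) dμ| ≤ λ ∫ f² dμ + λ⁻¹ ∫ h² dμ` (the tree's bound applied to `(√λ f, h/√λ)`). [folklore] -/
private theorem abs_kernelPairing_le_scaled (μ : Measure (PhaseSpace N)) [SFinite μ]
    (hinv : ∀ s : ℝ≥0, μ.bind ((pinnedChain ω₂ lam β γ).transitionKernel N a b s) = μ)
    {f h : PhaseSpace N → ℝ} (hf : Measurable f) (hh : Measurable h)
    (hf2 : Integrable (fun y => f y ^ 2) μ) (hh2 : Integrable (fun y => h y ^ 2) μ) (u : ℝ) {l : ℝ}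
    (hl0 : 0 < l) :
    |∫ y, f y * (∫ y', h y' ∂((pinnedChain ω₂ lam β γ).transitionKernel N a b u.toNNReal y)) ∂μ| ≤
      l * (∫ y, f y ^ 2 ∂μ) + l⁻¹ * ∫ y, h y ^ 2 ∂μ := by
  set s : ℝ := Real.sqrt l with hs
  have hs0 : 0 < s := Real.sqrt_pos.2 hl0
  have hs2 : s ^ 2 = l := Real.sq_sqrt hl0.le
  set f' : PhaseSpace N → ℝ := fun y => s * f y with hf'
  set h' : PhaseSpace N → ℝ := fun y => h y / s with hh'
  have hf'm : Measurable f' := hf.const_mul s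
  have hh'm : Measurable h' := hh.div_const s
  have hf'2 : Integrable (fun y => f' y ^ 2) μ := by
    have : (fun y => f' y ^ 2) = fun y => s ^ 2 * f y ^ 2 := by funext y; simp only [hf']; ring
    rw [this]; exact hf2.const_mul _
  have hh'2 : Integrable (fun y => h' y ^ 2) μ := by
    have : (fun y => h' y ^ 2) = fun y => (s ^ 2)⁻¹ * h y ^ 2 := by funext y; simp only [hh']; field_simp
    rw [this]; exact hh2.const_mul _
  have key := pinnedChain_abs_kernelPairing_le hω hl hβ hγ N a b μ hinv hf'm hh'm hf'2 hh'2 u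
  have e1 : ∀ y, f' y * (∫ y', h' y' ∂((pinnedChain ω₂ lam β γ).transitionKernel N a b u.toNNReal y)) =
      f y * ∫ y', h y' ∂((pinnedChain ω₂ lam β γ).transitionKernel N a b u.toNNReal y) := by
    intro y
    show s * f y * (∫ y', h y' / s ∂((pinnedChain ω₂ lam β γ).transitionKernel N a b u.toNNReal y)) = _
    rw [integral_div]
    field_simp
  have e2 : ∫ y, f' y ^ 2 ∂μ = l * ∫ y, f y ^ 2 ∂μ := by
    rw [← integral_const_mul]
    refine integral_congr_ae (Eventually.of_forall fun y => ?_)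
    show (s * f y) ^ 2 = l * f y ^ 2
    rw [mul_pow, hs2]
  have e3 : ∫ y, h' y ^ 2 ∂μ = l⁻¹ * ∫ y, h y ^ 2 ∂μ := by
    rw [← integral_const_mul]
    refine integral_congr_ae (Eventually.of_forall fun y => ?_)
    show (h y / s) ^ 2 = l⁻¹ * h y ^ 2
    rw [div_pow, hs2]; field_simp
  simp_rw [e1] at key
  rwa [e2, e3] at key

/-- **Energy truncation of the current–current pairing, uniformly in the temperatures** (the `μ`-part of
the `3ε` argument of K6b): for the pinned chain (`ω₂ > 0`, `lam, β, γ ≥ 0`), a probability law `μ`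
invariant under the kernels at temperatures `(a, b)` with `∫ e^{ϑH} dμ ≤ M` (`ϑ > 0`), a bond current `j = j_i`
dominated as `|j| ≤ C e^{ϑH/4}`, a real time `u` and a truncation level `K`, with
`χ_K(x) = max 0 (min 1 (K + 1 - H x))`:
`|∫ j·(P_{u⁺} j) dμ - ∫ (χ_K j)·(P_{u⁺}(χ_K j)) dμ| ≤ 2 √(C² e^{-ϑK/2} (M+1)) (1 + C² M)`. [folklore] -/
private theorem pairing_cutoff_approx (μ : Measure (PhaseSpace N)) [IsProbabilityMeasure μ]
    (hinv : ∀ s : ℝ≥0, μ.bind ((pinnedChain ω₂ lam β γ).transitionKernel N a b s) = μ)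
    (ha : 0 < a) (hb : 0 < b) {ϑ M C : ℝ} (hϑ : 0 < ϑ) (hϑab : ϑ / 4 < 1 / max a b)
    (hVint : Integrable (fun x => Real.exp (ϑ * (pinnedChain ω₂ lam β γ).hamiltonian N x)) μ)
    (hVM : ∫ x, Real.exp (ϑ * (pinnedChain ω₂ lam β γ).hamiltonian N x) ∂μ ≤ M) (i : Fin N) (hC0 : 0 ≤ C)
    (hC : ∀ x, |(pinnedChain ω₂ lam β γ).bondCurrent N i x| ≤
      C * Real.exp (ϑ / 4 * (pinnedChain ω₂ lam β γ).hamiltonian N x)) (u K : ℝ) :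
    |(∫ y, (pinnedChain ω₂ lam β γ).bondCurrent N i y *
        (∫ y', (pinnedChain ω₂ lam β γ).bondCurrent N i y'
          ∂((pinnedChain ω₂ lam β γ).transitionKernel N a b u.toNNReal y)) ∂μ) -
      ∫ y, (max 0 (min 1 (K + 1 - (pinnedChain ω₂ lam β γ).hamiltonian N y)) *
          (pinnedChain ω₂ lam β γ).bondCurrent N i y) *
        (∫ y', (max 0 (min 1 (K + 1 - (pinnedChain ω₂ lam β γ).hamiltonian N y')) *
          (pinnedChain ω₂ lam β γ).bondCurrent N i y')
          ∂((pinnedChain ω₂ lam β γ).transitionKernel N a b u.toNNReal y)) ∂μ| ≤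
      2 * Real.sqrt (C ^ 2 * Real.exp (-(ϑ / 2 * K)) * (M + 1)) * (1 + C ^ 2 * M) := by
  set P := pinnedChain ω₂ lam β γ with hP
  set H := P.hamiltonian N with hH
  have hHc : Continuous H := pinnedChain_continuous_hamiltonian ω₂ lam β γ N
  have hH0 : ∀ x, 0 ≤ H x := fun x => pinnedChain_hamiltonian_nonneg hω.le hl hβ γ N x
  set V : PhaseSpace N → ℝ := fun x => Real.exp (ϑ * H x) with hV
  set j := P.bondCurrent N i with hj
  have hjc : Continuous j := pinnedChain_continuous_bondCurrent ω₂ lam β γ N i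
  have hjm : Measurable j := hjc.measurable
  set χ : PhaseSpace N → ℝ := fun x => max 0 (min 1 (K + 1 - H x)) with hχ
  have hχc : Continuous χ := continuous_const.max (continuous_const.min (continuous_const.sub hHc))
  have hχ0 : ∀ x, 0 ≤ χ x := fun x => le_max_left _ _
  have hχ1 : ∀ x, χ x ≤ 1 := fun x => max_le zero_le_one (min_le_left _ _)
  have hχ_one : ∀ x, H x ≤ K → χ x = 1 := fun x hx => by
    show max 0 (min 1 (K + 1 - H x)) = 1
    rw [min_eq_left (by linarith only [hx]), max_eq_right zero_le_one]
  set jK : PhaseSpace N → ℝ := fun x => χ x * j x with hjK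
  have hjKm : Measurable jK := (hχc.mul hjc).measurable
  have hMnn : 0 ≤ M := le_trans (integral_nonneg fun x => (Real.exp_pos _).le) hVM
  set κ := P.transitionKernel N a b u.toNNReal with hκ
  haveI : IsMarkovKernel κ := pinnedChain_isMarkovKernel_transitionKernel hω hl hβ hγ N a b _
  -- pointwise bounds
  have hj2 : ∀ x, j x ^ 2 ≤ C ^ 2 * V x := fun x => by
    have h1 : j x ^ 2 ≤ (C * Real.exp (ϑ / 4 * H x)) ^ 2 := by
      rw [← sq_abs]; exact pow_le_pow_left₀ (abs_nonneg _) (hC x) 2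
    refine h1.trans ?_
    rw [mul_pow, ← Real.exp_nat_mul]
    refine mul_le_mul_of_nonneg_left (Real.exp_le_exp.2 ?_) (sq_nonneg _)
    push_cast
    nlinarith only [hH0 x, hϑ]
  have hjK2 : ∀ x, jK x ^ 2 ≤ j x ^ 2 := fun x => by
    show (χ x * j x) ^ 2 ≤ _
    rw [mul_pow]
    calc χ x ^ 2 * j x ^ 2 ≤ 1 * j x ^ 2 :=
          mul_le_mul_of_nonneg_right (pow_le_one₀ (hχ0 x) (hχ1 x)) (sq_nonneg _)
      _ = j x ^ 2 := one_mul _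
  have htail : ∀ x, (j x - jK x) ^ 2 ≤ C ^ 2 * Real.exp (-(ϑ / 2 * K)) * V x := fun x => by
    by_cases hx : H x ≤ K
    · show (j x - χ x * j x) ^ 2 ≤ _
      rw [hχ_one x hx, one_mul, sub_self, zero_pow two_ne_zero]; positivity
    · have hxK : K < H x := not_le.1 hx
      have h1 : (j x - jK x) ^ 2 ≤ j x ^ 2 := by
        show (j x - χ x * j x) ^ 2 ≤ _
        rw [show j x - χ x * j x = (1 - χ x) * j x by ring, mul_pow]
        calc (1 - χ x) ^ 2 * j x ^ 2 ≤ 1 * j x ^ 2 :=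
              mul_le_mul_of_nonneg_right (pow_le_one₀ (by linarith only [hχ1 x]) (by linarith only [hχ0 x]))
                (sq_nonneg _)
          _ = j x ^ 2 := one_mul _
      have h2 : j x ^ 2 ≤ C ^ 2 * Real.exp (ϑ / 2 * H x) := by
        have h1 : j x ^ 2 ≤ (C * Real.exp (ϑ / 4 * H x)) ^ 2 := by
          rw [← sq_abs]; exact pow_le_pow_left₀ (abs_nonneg _) (hC x) 2
        refine h1.trans (le_of_eq ?_)
        rw [mul_pow, ← Real.exp_nat_mul]; congr 1; push_cast; ring_nf
      refine h1.trans (h2.trans ?_)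
      rw [mul_assoc, ← Real.exp_add]
      refine mul_le_mul_of_nonneg_left (Real.exp_le_exp.2 ?_) (sq_nonneg _)
      nlinarith only [hxK, hϑ]
  -- integrability and the three `L²` norms
  have hj2i : Integrable (fun y => j y ^ 2) μ :=
    (hVint.const_mul (C ^ 2)).mono' (hjc.pow 2).aestronglyMeasurable (Eventually.of_forall fun x => by
      rw [Real.norm_eq_abs, abs_of_nonneg (sq_nonneg _)]; exact hj2 x)
  have hjK2i : Integrable (fun y => jK y ^ 2) μ :=
    hj2i.mono' ((hχc.mul hjc).pow 2).aestronglyMeasurable (Eventually.of_forall fun x => by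
      rw [Real.norm_eq_abs, abs_of_nonneg (sq_nonneg _)]; exact hjK2 x)
  have hd2i : Integrable (fun y => (j y - jK y) ^ 2) μ :=
    (hVint.const_mul (C ^ 2 * Real.exp (-(ϑ / 2 * K)))).mono' ((hjc.sub (hχc.mul hjc)).pow 2).aestronglyMeasurable
      (Eventually.of_forall fun x => by rw [Real.norm_eq_abs, abs_of_nonneg (sq_nonneg _)]; exact htail x)
  have hA : ∫ y, j y ^ 2 ∂μ ≤ C ^ 2 * M := by
    calc ∫ y, j y ^ 2 ∂μ ≤ ∫ y, C ^ 2 * V y ∂μ := integral_mono hj2i (hVint.const_mul _) hj2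
      _ = C ^ 2 * ∫ y, V y ∂μ := integral_const_mul _ _
      _ ≤ C ^ 2 * M := mul_le_mul_of_nonneg_left hVM (sq_nonneg _)
  have hAK : ∫ y, jK y ^ 2 ∂μ ≤ C ^ 2 * M := (integral_mono hjK2i hj2i hjK2).trans hA
  set τ : ℝ := C ^ 2 * Real.exp (-(ϑ / 2 * K)) * (M + 1) with hτ
  have hτ0 : 0 < τ ∨ C = 0 := by
    rcases eq_or_lt_of_le hC0 with h | h
    · exact Or.inr h.symm
    · exact Or.inl (by positivity)
  have hD : ∫ y, (j y - jK y) ^ 2 ∂μ ≤ τ := by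
    calc ∫ y, (j y - jK y) ^ 2 ∂μ ≤ ∫ y, C ^ 2 * Real.exp (-(ϑ / 2 * K)) * V y ∂μ :=
          integral_mono hd2i (hVint.const_mul _) htail
      _ = C ^ 2 * Real.exp (-(ϑ / 2 * K)) * ∫ y, V y ∂μ := integral_const_mul _ _
      _ ≤ C ^ 2 * Real.exp (-(ϑ / 2 * K)) * M := mul_le_mul_of_nonneg_left hVM (by positivity)
      _ ≤ τ := by rw [hτ]; nlinarith only [sq_nonneg C, Real.exp_pos (-(ϑ / 2 * K)), hMnn]
  -- integrability of the currents against each `P_u(y, ·)` ((3.4) at the exponent `ϑ/4`)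
  have hN0 : 0 < N := Fin.pos i
  have hjκ : ∀ y, Integrable j (κ y) := by
    intro y
    have h34 := lintegral_exp_mul_hamiltonian_pinnedChainSemigroup_le hω hl hβ hγ hN0 ha.le hb.le ha hb
      (θ := ϑ / 4) (by positivity) hϑab u.toNNReal y
    have hexp : Integrable (fun x => Real.exp (ϑ / 4 * H x)) (κ y) := by
      refine ⟨(Real.continuous_exp.comp (continuous_const.mul hHc)).aestronglyMeasurable, ?_⟩
      show ∫⁻ x, ‖Real.exp (ϑ / 4 * H x)‖ₑ ∂(κ y) < (⊤ : ℝ≥0∞)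
      have : ∫⁻ x, ‖Real.exp (ϑ / 4 * H x)‖ₑ ∂(κ y) = ∫⁻ x, ENNReal.ofReal (Real.exp (ϑ / 4 * H x)) ∂(κ y) :=
        lintegral_congr fun x => Real.enorm_eq_ofReal (Real.exp_pos _).le
      rw [this]
      exact lt_of_le_of_lt h34 ENNReal.ofReal_lt_top
    exact (hexp.const_mul C).mono' hjc.aestronglyMeasurable (Eventually.of_forall fun x => by
      rw [Real.norm_eq_abs]; exact hC x)
  have hjKκ : ∀ y, Integrable jK (κ y) := fun y =>
    (hjκ y).norm.mono' (hχc.mul hjc).aestronglyMeasurable (Eventually.of_forall fun x => by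
      show ‖χ x * j x‖ ≤ ‖j x‖
      rw [norm_mul, Real.norm_eq_abs, abs_of_nonneg (hχ0 x)]
      calc χ x * ‖j x‖ ≤ 1 * ‖j x‖ := mul_le_mul_of_nonneg_right (hχ1 x) (norm_nonneg _)
        _ = ‖j x‖ := one_mul _)
  -- split `∫ j·Pj - ∫ jK·PjK = ∫ (j - jK)·Pj + ∫ jK·P(j - jK)`
  have hI1 := (pinnedChain_integrable_mul_act_of_invariant hω hl hβ hγ N a b μ u.toNNReal (hinv _) hjm hjm
    hj2i hj2i).1
  have hI2 := (pinnedChain_integrable_mul_act_of_invariant hω hl hβ hγ N a b μ u.toNNReal (hinv _) hjKm hjKm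
    hjK2i hjK2i).1
  have hdm : Measurable (fun y => j y - jK y) := hjm.sub hjKm
  have hI3 := (pinnedChain_integrable_mul_act_of_invariant hω hl hβ hγ N a b μ u.toNNReal (hinv _)
    (f := fun y => j y - jK y) (h := j) hdm hjm hd2i hj2i).1
  have hI4 := (pinnedChain_integrable_mul_act_of_invariant hω hl hβ hγ N a b μ u.toNNReal (hinv _)
    (f := jK) (h := fun y => j y - jK y) hjKm hdm hjK2i hd2i).1
  have hsplit : (∫ y, j y * (∫ y', j y' ∂κ y) ∂μ) - ∫ y, jK y * (∫ y', jK y' ∂κ y) ∂μ =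
      (∫ y, (j y - jK y) * (∫ y', j y' ∂κ y) ∂μ) + ∫ y, jK y * (∫ y', (j y' - jK y') ∂κ y) ∂μ := by
    rw [← integral_sub hI1 hI2, ← integral_add hI3 hI4]
    refine integral_congr_ae (Eventually.of_forall fun y => ?_)
    simp only
    rw [integral_sub (hjκ y) (hjKκ y)]
    ring
  -- the two rescaled `L²` bounds
  have hfinal : |(∫ y, j y * (∫ y', j y' ∂κ y) ∂μ) - ∫ y, jK y * (∫ y', jK y' ∂κ y) ∂μ| ≤
      2 * Real.sqrt τ * (1 + C ^ 2 * M) := by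
    rcases hτ0 with hτ0 | hC00
    · set s : ℝ := Real.sqrt τ with hs
      have hs0 : 0 < s := Real.sqrt_pos.2 hτ0
      have hs2 : s * s = τ := Real.mul_self_sqrt hτ0.le
      have hb1 := abs_kernelPairing_le_scaled hω hl hβ hγ N a b μ hinv (hjm.sub hjKm) hjm hd2i hj2i u
        (l := s⁻¹) (inv_pos.2 hs0)
      have hb2 := abs_kernelPairing_le_scaled hω hl hβ hγ N a b μ hinv hjKm (hjm.sub hjKm) hjK2i hd2i u hs0
      rw [inv_inv] at hb1
      rw [hsplit]
      refine (abs_add_le _ _).trans ?_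
      have h1 : s⁻¹ * ∫ y, (j y - jK y) ^ 2 ∂μ ≤ s := by
        rw [inv_mul_le_iff₀ hs0, hs2]; exact hD
      have h2 : s * ∫ y, j y ^ 2 ∂μ ≤ s * (C ^ 2 * M) := mul_le_mul_of_nonneg_left hA hs0.le
      have h3 : s * ∫ y, jK y ^ 2 ∂μ ≤ s * (C ^ 2 * M) := mul_le_mul_of_nonneg_left hAK hs0.le
      calc |∫ y, (j y - jK y) * (∫ y', j y' ∂κ y) ∂μ| + |∫ y, jK y * (∫ y', (j y' - jK y') ∂κ y) ∂μ|
          ≤ (s⁻¹ * ∫ y, (j y - jK y) ^ 2 ∂μ + s * ∫ y, j y ^ 2 ∂μ) +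
            (s * ∫ y, jK y ^ 2 ∂μ + s⁻¹ * ∫ y, (j y - jK y) ^ 2 ∂μ) := add_le_add hb1 hb2
        _ ≤ (s + s * (C ^ 2 * M)) + (s * (C ^ 2 * M) + s) := by linarith only [h1, h2, h3]
        _ = 2 * s * (1 + C ^ 2 * M) := by ring
    · -- `C = 0`: the current vanishes identically
      have hj0 : ∀ x, j x = 0 := fun x => by
        have := hC x; rw [hC00, zero_mul] at this; exact abs_nonpos_iff.1 this
      have hjK0 : ∀ x, jK x = 0 := fun x => by show χ x * j x = 0; rw [hj0 x, mul_zero]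
      simp only [hj0, hjK0, zero_mul, integral_zero, sub_self, abs_zero]
      positivity
  exact hfinal

end Pairing

/-- **Energy truncation of the current–current pairing** (registered sub-goal of
`stub_bondHeatVarianceContinuity`; closed form of `pairing_cutoff_approx`): for the pinned chain (`ω₂ > 0`,
`lam, β, γ ≥ 0`), a probability law `μ` invariant under the kernels at temperatures `a, b > 0` with
`∫ e^{ϑH} dμ ≤ M`, `0 < ϑ`, `ϑ/4 < 1/max(a,b)`, a bond current dominated as `|j_i| ≤ C e^{ϑH/4}` (`C ≥ 0`), a
real time `u` and a level `K`:
`|∫ j·(P_{u⁺} j) dμ - ∫ (χ_K j)·(P_{u⁺}(χ_K j)) dμ| ≤ 2 √(C² e^{-ϑK/2} (M+1)) (1 + C² M)`,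
`χ_K = max 0 (min 1 (K + 1 - H))`. [folklore] -/
theorem pairingCutoffApprox :
    ∀ (ω₂ lam β γ : ℝ), 0 < ω₂ → 0 ≤ lam → 0 ≤ β → 0 ≤ γ → ∀ (N : ℕ) (a b : ℝ)
      (μ : Measure (PhaseSpace N)), IsProbabilityMeasure μ →
      (∀ s : ℝ≥0, μ.bind ((pinnedChain ω₂ lam β γ).transitionKernel N a b s) = μ) →
      0 < a → 0 < b → ∀ (ϑ M C : ℝ), 0 < ϑ → ϑ / 4 < 1 / max a b →
      Integrable (fun x => Real.exp (ϑ * (pinnedChain ω₂ lam β γ).hamiltonian N x)) μ →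
      ∫ x, Real.exp (ϑ * (pinnedChain ω₂ lam β γ).hamiltonian N x) ∂μ ≤ M →
      ∀ (i : Fin N), 0 ≤ C →
      (∀ x, |(pinnedChain ω₂ lam β γ).bondCurrent N i x| ≤
        C * Real.exp (ϑ / 4 * (pinnedChain ω₂ lam β γ).hamiltonian N x)) →
      ∀ (u K : ℝ),
      |(∫ y, (pinnedChain ω₂ lam β γ).bondCurrent N i y *
          (∫ y', (pinnedChain ω₂ lam β γ).bondCurrent N i y'
            ∂((pinnedChain ω₂ lam β γ).transitionKernel N a b u.toNNReal y)) ∂μ) -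
        ∫ y, (max 0 (min 1 (K + 1 - (pinnedChain ω₂ lam β γ).hamiltonian N y)) *
            (pinnedChain ω₂ lam β γ).bondCurrent N i y) *
          (∫ y', (max 0 (min 1 (K + 1 - (pinnedChain ω₂ lam β γ).hamiltonian N y')) *
            (pinnedChain ω₂ lam β γ).bondCurrent N i y')
            ∂((pinnedChain ω₂ lam β γ).transitionKernel N a b u.toNNReal y)) ∂μ| ≤
        2 * Real.sqrt (C ^ 2 * Real.exp (-(ϑ / 2 * K)) * (M + 1)) * (1 + C ^ 2 * M) := by
  intro ω₂ lam β γ hω hl hβ hγ N a b μ hμ hinv ha hb ϑ M C hϑ hϑab hVint hVM i hC0 hC u K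
  exact pairing_cutoff_approx hω hl hβ hγ N a b μ hinv ha hb hϑ hϑab hVint hVM i hC0 hC u K

end Summit.AtomisticToContinuum.FouriersLaw.Theorems.LinearResponseFTUR

end
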